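import Literature.IUT.HodgeTheaters.Cor53InjectiveOfMonoidRigidity
import Literature.AlgebraicGeometry.Frobenioids.Cor411Padic
import HarnessLib

/-!
# [IUTchI] Cor 5.3 (ii), non-archimedean model case AT a `p`-adic Frobenioid ([FrdII] Ex 1.1): «`Aut(𝒞_v) → Aut(𝒟_v)`»
# injective mod ONE law / bijective mod ONE law + lifting (proof-only; T5 «COR53II-AT-GENUINE-PLACE» core layer)

S. Mochizuki, *Inter-universal Teichmüller theory I*, kurims manuscript (May 2020), §5 Corollary 5.3 (ii) p. 144
l. 14–18 («the natural map `Isom(¹𝔉, ²𝔉) → Isom(¹𝔇, ²𝔇)` is bijective»), proof p. 144 l. 33–36 («follows immediately from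
[AbsTopIII], Proposition 3.2, (iv) …»); Example 3.3 (i) p. 77 («`𝒞_v` … the `p_v`-adic Frobenioid … base category
`𝒟_v`») ([IUTchI] Cor 5.3 (ii) p.144) [claim: Mochizuki2012, status: disputed] (D-0012 claim key; nothing of the series
is asserted; no side taken on [IUTchIII] Cor. 3.12).  S. Mochizuki, *The geometry of Frobenioids II*, Ex. 1.1 / Thm 1.2
(i) (the `p`-adic Frobenioid is of standard type) [cite: MochizukiFrdII2008, Thm 1.2 (i) p.9] — abc-iut-L1-t4's
`PadicFrd.Datum D p` with `d.frobenioid = ModelFrobenioid d.Φ d.B d.divB`.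

PROOF-ONLY (theorems only).  L5-lead RULINGS #113 (2): T5 := «COR53II-AT-GENUINE-PLACE» — per place TYPE, at the
named genuine carriers, prove `CatIsomorphism.DescendBijective (baseFunctor C_v) (baseFunctor C_v) he hu` from the rigidity
rows ∧ lifting BY NAME.  This file is the `p`-ADIC-FROBENIOID LAYER of that assembly (every REAL good-place carrier
`GoodLocalFrobenioid.ofGalois …` has `C_v = (PadicFrd.Datum …).frobenioid`, `PadicFrobenioidGoodLocalKit.CvOver`):
* `Cor53.padic_preservesDegFr` — every self-equivalence of a `p`-adic Frobenioid over a slim base of FSM-type preserves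
  Frobenius degrees ([FrdI] Cor 4.11 (iv) via abc-iut-w4-d109's `PadicFrd.cor411Setting_padic` + abc-iut-L1-d6's
  `FrdI.preservesDegFr_of_cor411Setting`; standard type = [FrdII] Thm 1.2 (i), discharged in the tree);
* `Cor53.padic_descend_injective_of_monoidRigid` — for ANY binders `he`/`hu` (abc-iut-w4-d109's T3 supplies them at the
  REAL carriers, `GoodLocalFrobenioidOfGaloisCor411` p493264 + sequel), `Aut(𝒞_v) → Aut(𝒟_v)` is INJECTIVE modulo the ONE
  LAW hmon «every self-equivalence over the identity of `𝒟_v` induces the identity on `Φ = ord(𝒪^⊳)` and on `B = K^×`»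
  (the `deg_Fr` clause being DISCHARGED here) — hmon is row «C53ii/S2c HMON-AT-REAL-CV» (abc-iut-L1-t7; from the Kummer
  pair rigidity N1 p489714 / N3 p490952 / N3c p493397 / N3b);
* `Cor53.padic_descendBijective_of_monoidRigid_of_lifts` — BIJECTIVE (print's statement at the place) modulo hmon and the
  lifting hypothesis hlift (surjectivity: [AbsTopIII] Prop 3.2 (iv) bijectivity schema F-0409 `GaloisIsoLiftsToTMPairIso`,
  instance p432154, + the construction's functoriality — BY NAME, displayed).
Binder census of the bijective form: LAW {hmon} · FACT {hlift} · by-name {IsOfFSMType D, IsSlim D} · binders {he, hu}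
(w4-d109: hypothesis-free at the genuine place) · DATA `d : PadicFrd.Datum D p`.  Typed ≠ proved for hmon/hlift.
-/

namespace Literature.IUT.HodgeTheaters

open CategoryTheory Opposite Literature.AlgebraicGeometry.Frobenioids

universe v u

namespace Cor53

variable {D : Type u} [Category.{v} D] {p : ℕ} [Fact p.Prime] (d : PadicFrd.Datum D p)

/-- **Every self-equivalence of a `p`-adic Frobenioid over a slim base of FSM-type preserves Frobenius degrees**
([FrdI] Cor 4.11 (iv) / Thm 3.4 (iii) at [FrdII] Ex 1.1; the `deg_Fr` clause of print's S2 criterion, DISCHARGED).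
([IUTchI] Cor 5.3 (ii) p.144) [claim: Mochizuki2012, status: disputed] -/
theorem padic_preservesDegFr (hD : IsOfFSMType D) (hsl : IsSlim D) (Ψ : d.frobenioid ≌ d.frobenioid)
    ⦃X Y : d.frobenioid⦄ (φ : X ⟶ Y) :
    ModelFrobenioid.degFr (Ψ.functor.map φ) = ModelFrobenioid.degFr φ :=
  FrdI.preservesDegFr_of_cor411Setting (d.isFrobenioid_of_isOfFSMType hD) (d.isFrobenioid_of_isOfFSMType hD) Ψ
    (PadicFrd.cor411Setting_padic d d hD hD hsl hsl Ψ) φ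

/-- **[IUTchI] Cor 5.3 (ii), non-archimedean model case at a `p`-adic Frobenioid — INJECTIVITY modulo ONE law.**
For `𝒞_v = d.frobenioid` over `𝒟_v = D` (slim, FSM-type) and ANY binders `he`/`hu` of the §0 natural map (supplied
hypothesis-free at the REAL good places by abc-iut-w4-d109's T3), `Aut(𝒞_v) → Aut(𝒟_v)` (`CatIsomorphism.descend he hu`)
is injective provided (LAW hmon, row S2c) every self-equivalence of `𝒞_v` over the identity of `𝒟_v` induces the
identity on `Φ` and on `B` through some base identification `η`.  The `deg_Fr` clause of abc-iut-L1-t7's criterion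
is discharged by `padic_preservesDegFr`. ([IUTchI] Cor 5.3 (ii) p.144) [claim: Mochizuki2012, status: disputed] -/
theorem padic_descend_injective_of_monoidRigid (hD : IsOfFSMType D) (hsl : IsSlim D)
    (he : CatIsomorphism.HasUnder (ModelFrobenioid.baseFunctor d.Φ d.B d.divB) (ModelFrobenioid.baseFunctor d.Φ d.B d.divB))
    (hu : CatIsomorphism.UnderUnique (ModelFrobenioid.baseFunctor d.Φ d.B d.divB)
      (ModelFrobenioid.baseFunctor d.Φ d.B d.divB))
    (hmon : ∀ Ψ : d.frobenioid ≌ d.frobenioid,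
      Nonempty (Ψ.functor ⋙ ModelFrobenioid.baseFunctor d.Φ d.B d.divB ≅ ModelFrobenioid.baseFunctor d.Φ d.B d.divB) →
      ∃ η : Ψ.functor ⋙ ModelFrobenioid.baseFunctor d.Φ d.B d.divB ≅ ModelFrobenioid.baseFunctor d.Φ d.B d.divB,
        (∀ ⦃X Y : d.frobenioid⦄ (φ : X ⟶ Y),
            ModelFrobenioid.div (Ψ.functor.map φ) =
              pull d.Φ (η.hom.app X : (Ψ.functor.obj X).base ⟶ X.base) (ModelFrobenioid.div φ)) ∧
        (∀ ⦃X Y : d.frobenioid⦄ (φ : X ⟶ Y),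
            ModelFrobenioid.unit (Ψ.functor.map φ) =
              pull d.B (η.hom.app X : (Ψ.functor.obj X).base ⟶ X.base) (ModelFrobenioid.unit φ))) :
    Function.Injective (CatIsomorphism.descend he hu) := by
  refine descend_injective_of_monoidRigid he hu fun Ψ hΨ => ?_
  obtain ⟨η, hdiv, hunit⟩ := hmon Ψ hΨ
  exact ⟨η, padic_preservesDegFr d hD hsl Ψ, hdiv, hunit⟩

/-- **[IUTchI] Cor 5.3 (ii), non-archimedean model case at a `p`-adic Frobenioid — AS PRINTED («bijective»)** modulo
the LAW hmon (injectivity content) and the lifting hypothesis hlift (surjectivity: [AbsTopIII] Prop 3.2 (iv)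
bijectivity, FACT-schema F-0409 instance p432154, through the construction's functoriality — BY NAME).
([IUTchI] Cor 5.3 (ii) p.144) [claim: Mochizuki2012, status: disputed] -/
theorem padic_descendBijective_of_monoidRigid_of_lifts (hD : IsOfFSMType D) (hsl : IsSlim D)
    (he : CatIsomorphism.HasUnder (ModelFrobenioid.baseFunctor d.Φ d.B d.divB) (ModelFrobenioid.baseFunctor d.Φ d.B d.divB))
    (hu : CatIsomorphism.UnderUnique (ModelFrobenioid.baseFunctor d.Φ d.B d.divB)
      (ModelFrobenioid.baseFunctor d.Φ d.B d.divB))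
    (hmon : ∀ Ψ : d.frobenioid ≌ d.frobenioid,
      Nonempty (Ψ.functor ⋙ ModelFrobenioid.baseFunctor d.Φ d.B d.divB ≅ ModelFrobenioid.baseFunctor d.Φ d.B d.divB) →
      ∃ η : Ψ.functor ⋙ ModelFrobenioid.baseFunctor d.Φ d.B d.divB ≅ ModelFrobenioid.baseFunctor d.Φ d.B d.divB,
        (∀ ⦃X Y : d.frobenioid⦄ (φ : X ⟶ Y),
            ModelFrobenioid.div (Ψ.functor.map φ) =
              pull d.Φ (η.hom.app X : (Ψ.functor.obj X).base ⟶ X.base) (ModelFrobenioid.div φ)) ∧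
        (∀ ⦃X Y : d.frobenioid⦄ (φ : X ⟶ Y),
            ModelFrobenioid.unit (Ψ.functor.map φ) =
              pull d.B (η.hom.app X : (Ψ.functor.obj X).base ⟶ X.base) (ModelFrobenioid.unit φ)))
    (hlift : ∀ Θ : D ≌ D, ∃ Ψ : d.frobenioid ≌ d.frobenioid,
      Nonempty (CatIsomorphism.LiesUnder (ModelFrobenioid.baseFunctor d.Φ d.B d.divB)
        (ModelFrobenioid.baseFunctor d.Φ d.B d.divB) Ψ Θ)) :
    CatIsomorphism.DescendBijective (ModelFrobenioid.baseFunctor d.Φ d.B d.divB)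
      (ModelFrobenioid.baseFunctor d.Φ d.B d.divB) he hu :=
  ⟨padic_descend_injective_of_monoidRigid d hD hsl he hu hmon, CatIsomorphism.descend_surjective_of_lifts he hu hlift⟩

end Cor53

end Literature.IUT.HodgeTheaters
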